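import Summits.AtomisticToContinuum.HydrodynamicLimit.Theses.OneFlightGossipEngine
import HarnessLib

/-!
# Quartic docking for the crux `EnergyCurrentTails` (stmt-AtomisticToContinuum-9235): a uniform
# quartic velocity moment along the flow implies the cubic uniform integrability

Helper file of the line lead (prover-line-stmt-AtomisticToContinuum-9235-0) for the registered audit
stub `stub_quarticDocking` of the line `IdeatorThreeSketch` (`Cruxes/EnergyCurrentTails/Lines/`).

The line's open transfer statement (`stub_exergyInfluence` ⟺ a Gaussian envelope of the evolved
one-particle velocity marginals, `stub_marginalEnvelope_iff`) is much STRONGER than what the crux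
consumes.  The weakest natural transfer statement is a uniform QUARTIC MOMENT bound along the true
flow, `E_{λ_N}[(N+1)⁻¹ ∑ᵢ |vᵢ(s)|⁴] ≤ C` for `N ≥ N₀`, `s ≤ t < T` (typed `QuarticMomentBound` in the
ideator-2 sketch `Cruxes/EnergyCurrentTails/IdeatorTwoSketch.lean`, card `quartic-disparity-closure`,
planner-cruxidea-stmt-AtomisticToContinuum-9235-2-0, where the implication below was first checked):
by Chebyshev inside the integral, `𝟙{M < |v|}|v|³ ≤ |v|⁴/M`, it gives the crux with
`M = |C|/ε + 1` (`stub_quarticDocking`).  By the line's tagging identity the quartic moment has the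
same G-side reading as the Gaussian envelope (`E_λ[|vᵢ(s)|⁴] = ∫ |vᵢ|⁴ F(flip Φ_s z) dG`,
`lintegral_mul_density_flipVel_flow` of the marginal-form file), so a planner promoting the open
content of this crux may choose the quartic (weakest), a Gaussian TAIL envelope, or the full marginal
envelope — all three dock here or in `…EnergyCurrentTailsDocking.lean`.

References: Olla–Varadhan–Yau 1993 §1 (the cut-off functional); Spohn 1991 Part I Ch. 3.
-/

noncomputable section

open MeasureTheory Set Filter
open scoped ENNReal

namespace Summit.AtomisticToContinuum.HydrodynamicLimit.Theorems.LoschmidtTagging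

open Literature.MathematicalPhysics.KineticTheory Literature.Analysis.FluidPDE

/-- Termwise Chebyshev: `𝟙{M < ‖v‖} ‖v‖³ ≤ ‖v‖⁴ / M` for `M > 0` (adapted from
`IdeatorTwo.indicator_cubic_le_quartic_div`, `Cruxes/EnergyCurrentTails/IdeatorTwoSketch.lean`). -/
theorem indicator_cubic_le_inv_mul_quartic {E : Type*} [NormedAddCommGroup E] {M : ℝ} (hM : 0 < M)
    (v : E) :
    Set.indicator {x : E | M < ‖x‖} (fun x => ‖x‖ ^ 3) v ≤ M⁻¹ * ‖v‖ ^ 4 := by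
  by_cases hv : v ∈ {x : E | M < ‖x‖}
  · rw [Set.indicator_of_mem hv]
    have hv' : M < ‖v‖ := hv
    rw [le_inv_mul_iff₀ hM]
    calc M * ‖v‖ ^ 3 ≤ ‖v‖ * ‖v‖ ^ 3 := by gcongr
      _ = ‖v‖ ^ 4 := by ring
  · rw [Set.indicator_of_notMem hv]
    positivity

/-- Finite sums: `∑ᵢ 𝟙{M < ‖vᵢ‖} ‖vᵢ‖³ ≤ M⁻¹ ∑ᵢ ‖vᵢ‖⁴` (adapted from
`IdeatorTwo.cubic_tail_le_quartic`). -/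
theorem sum_indicator_cubic_le_inv_mul_sum_quartic {ι : Type*} (s : Finset ι) {E : Type*}
    [NormedAddCommGroup E] {M : ℝ} (hM : 0 < M) (v : ι → E) :
    (∑ i ∈ s, Set.indicator {x : E | M < ‖x‖} (fun x => ‖x‖ ^ 3) (v i))
      ≤ M⁻¹ * ∑ i ∈ s, ‖v i‖ ^ 4 := by
  rw [Finset.mul_sum]
  exact Finset.sum_le_sum fun i _ => indicator_cubic_le_inv_mul_quartic hM (v i)

/-- **Registered audit stub `stub_quarticDocking`** of the line `IdeatorThreeSketch` (crux
stmt-AtomisticToContinuum-9235): a uniform QUARTIC MOMENT bound along the true flow — the hypothesis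
is the body of `QuarticMomentBound` of the ideator-2 sketch, verbatim — implies
`OneFlightGossipEngine.EnergyCurrentTails`, with `M = |C|/ε + 1` (Chebyshev under the integral;
transfer first checked in `Cruxes/EnergyCurrentTails/IdeatorTwoSketch.lean`,
`energyCurrentTails_of_quarticMomentBound`, adapted here). -/
theorem stub_quarticDocking :
    (∀ (a₀ θ₀ : T3 → ℝ) (u₀ : T3 → V3), Continuous a₀ → Continuous θ₀ → Continuous u₀ →
      (∀ x, 0 < a₀ x) → (∀ x, 0 < θ₀ x) → ∃ σ₀ : ℝ, 0 < σ₀ ∧ ∀ σ : ℝ, 0 < σ → σ < σ₀ →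
      ∀ (T : ℝ) (ρ θ : ℝ → T3 → ℝ) (u : ℝ → T3 → V3), IsHardSphereEulerSolution σ T ρ u θ →
      ∀ Φ : (N : ℕ) → HardSphereFlow (Torus.geometry (Fin 3)) (hsDiameter σ N) (N + 1),
      TendstoHydroFieldsAt (fun N => localGibbsLaw σ a₀ u₀ θ₀ N (Φ N)) Φ ρ u θ 0 →
      ∀ t ∈ Set.Ico 0 T, ∃ C : ℝ, ∃ N₀ : ℕ, ∀ N : ℕ, N₀ ≤ N → ∀ s ∈ Set.Icc 0 t,
        ∫⁻ z, ENNReal.ofReal (((N : ℝ) + 1)⁻¹ * ∑ i : Fin (N + 1), ‖((Φ N).flow s z i).2‖ ^ 4)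
          ∂(localGibbsLaw σ a₀ u₀ θ₀ N (Φ N)) ≤ ENNReal.ofReal C) →
    Summit.AtomisticToContinuum.HydrodynamicLimit.Theses.OneFlightGossipEngine.EnergyCurrentTails := by
  intro hQ a₀ θ₀ u₀ ha hθ hu ha0 hθ0
  obtain ⟨σ₀, hσ₀, hσ⟩ := hQ a₀ θ₀ u₀ ha hθ hu ha0 hθ0
  refine ⟨σ₀, hσ₀, fun σ hs hs' T ρ θ u hE Φ h0 t ht ε hε => ?_⟩
  obtain ⟨C, N₀, hC⟩ := hσ σ hs hs' T ρ θ u hE Φ h0 t ht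
  set M : ℝ := |C| / ε + 1 with hMdef
  have hMpos : 0 < M := by positivity
  refine ⟨M, N₀, fun N hN s hs => ?_⟩
  have hkey := hC N hN s hs
  -- pointwise Chebyshev transfer inside the integral
  have hpt : ∀ z : Config (N + 1) (Fin 3) T3,
      ENNReal.ofReal (((N : ℝ) + 1)⁻¹ * ∑ i : Fin (N + 1),
          Set.indicator {v : V3 | M < ‖v‖} (fun v => ‖v‖ ^ 3) (((Φ N).flow s z i).2))
        ≤ ENNReal.ofReal M⁻¹ *
          ENNReal.ofReal (((N : ℝ) + 1)⁻¹ * ∑ i : Fin (N + 1), ‖((Φ N).flow s z i).2‖ ^ 4) := by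
    intro z
    rw [← ENNReal.ofReal_mul (inv_nonneg.2 hMpos.le)]
    apply ENNReal.ofReal_le_ofReal
    have hN1 : (0 : ℝ) ≤ ((N : ℝ) + 1)⁻¹ := by positivity
    have h := sum_indicator_cubic_le_inv_mul_sum_quartic (Finset.univ : Finset (Fin (N + 1))) hMpos
      (fun i => ((Φ N).flow s z i).2)
    calc ((N : ℝ) + 1)⁻¹ * ∑ i : Fin (N + 1),
            Set.indicator {v : V3 | M < ‖v‖} (fun v => ‖v‖ ^ 3) (((Φ N).flow s z i).2)
          ≤ ((N : ℝ) + 1)⁻¹ * (M⁻¹ * ∑ i : Fin (N + 1), ‖((Φ N).flow s z i).2‖ ^ 4) :=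
            mul_le_mul_of_nonneg_left h hN1
      _ = M⁻¹ * (((N : ℝ) + 1)⁻¹ * ∑ i : Fin (N + 1), ‖((Φ N).flow s z i).2‖ ^ 4) := by ring
  calc ∫⁻ z, ENNReal.ofReal (((N : ℝ) + 1)⁻¹ * ∑ i : Fin (N + 1),
          Set.indicator {v : V3 | M < ‖v‖} (fun v => ‖v‖ ^ 3) (((Φ N).flow s z i).2))
          ∂(localGibbsLaw σ a₀ u₀ θ₀ N (Φ N))
        ≤ ∫⁻ z, ENNReal.ofReal M⁻¹ *
          ENNReal.ofReal (((N : ℝ) + 1)⁻¹ * ∑ i : Fin (N + 1), ‖((Φ N).flow s z i).2‖ ^ 4)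
          ∂(localGibbsLaw σ a₀ u₀ θ₀ N (Φ N)) := lintegral_mono hpt
    _ = ENNReal.ofReal M⁻¹ * ∫⁻ z,
          ENNReal.ofReal (((N : ℝ) + 1)⁻¹ * ∑ i : Fin (N + 1), ‖((Φ N).flow s z i).2‖ ^ 4)
          ∂(localGibbsLaw σ a₀ u₀ θ₀ N (Φ N)) :=
          lintegral_const_mul' _ _ ENNReal.ofReal_ne_top
    _ ≤ ENNReal.ofReal M⁻¹ * ENNReal.ofReal C := by gcongr
    _ = ENNReal.ofReal (M⁻¹ * C) := (ENNReal.ofReal_mul (inv_nonneg.2 hMpos.le)).symm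
    _ ≤ ENNReal.ofReal ε := by
          apply ENNReal.ofReal_le_ofReal
          have h1 : M⁻¹ * C ≤ M⁻¹ * |C| :=
            mul_le_mul_of_nonneg_left (le_abs_self C) (inv_nonneg.2 hMpos.le)
          have h2 : M⁻¹ * |C| ≤ ε := by
            rw [inv_mul_le_iff₀ hMpos, hMdef]
            have : |C| = (|C| / ε) * ε := by field_simp
            nlinarith [abs_nonneg C, hε.le]
          exact h1.trans h2

end Summit.AtomisticToContinuum.HydrodynamicLimit.Theorems.LoschmidtTagging

end
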